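/-
Copyright (c) 2026 the pub-hodgecm-mathlib formalisation cell (harness21).  Prover seat hodgecm-mathlib-K2E3-p03 (g0), HCML Track B «K2-LIT», line lead of U3-d;
FILE C glue of the U3-d line-lead deal spec (2026-09-03): the scaling law of ONE unipotent orbital integral from a normalising conjugator and ONE index identity.
-/
import Summits.HodgeConjecture.HodgeConjecture.Theorems.K2E3InvariantQuotientNormalizerScaling   -- ★ p855345 (this seat): `exists_orbitalIntegral_conj_eq_smul_of_normalizes`, `mul_conj_comm_of_normalizes`
import Literature.NumberTheory.Automorphic.LocalOrbitalIntegral                                -- ★ `OrbitalMeasureFamily`, `classOrbitalIntegral`, `orbitalIntegral_eq_integral_descConj`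
import HarnessLib

/-!
# K2 · E3 — `Theorems/K2E3UnipotentOrbitalScalingOfIndex.lean`: THE SCALING LAW `Φ_μ(u₀, 1_{U₀}·(F∘Ψ)) = r · Φ_μ(u₀, F)` FROM A CONJUGATOR `h` WITH `Ψ(u₀) = h u₀ h⁻¹`
# NORMALISING `Z(u₀)` AND ONE INDEX IDENTITY `r · ρ(Z(u₀) ∩ hKh⁻¹) = ρ(Z(u₀) ∩ K)` (road H-a′ of the U3-d line; HC 1999 §3.1 L. 3.2 in group clothing)

HCML Track B «K2-LIT», cell `pub/hodgecm-mathlib`, crux H413 = `stmt-HodgeConjecture-24833` (lane `--supports … --as helper`); seat `hodgecm-mathlib-K2E3-p03` (g0), line lead of U3-d.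
GLUE for FILE C (`K2E3UnipotentOrbitalScalingLaw`, the XL letter ‹SC-explicit› of the line): it turns the SCALING LAW clause (SC) of ‹Ψ-package› (★ p855276) at ONE element `u₀` into
PURE ALGEBRA + ONE INDEX COUNT, the measure theory being ★ p855345.  Generic in the group `G` (locally compact, second countable, Hausdorff), the self-map `Ψ` and the
`Ad`-stable set `U₀` on which `Ψ` is `Ad`-equivariant — no unitary-group structure is used.

THE STATEMENT `integral_descConj_indicator_comp_eq_smul_of_conj_of_index`.  Let `Ψ(xγx⁻¹) = xΨ(γ)x⁻¹` for `γ ∈ U₀`, and let `u₀ ∈ G` have ALL its conjugates in `U₀`.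
Suppose there is `h ∈ G` with `Ψ(u₀) = h u₀ h⁻¹` and `hZ(u₀)h⁻¹ = Z(u₀)`, a compact open subgroup `K ≤ G` and a left-invariant measure `ρ` on `Z(u₀)` (finite on compacts,
positive on opens) with `r · ρ(Z(u₀) ∩ hKh⁻¹) = ρ(Z(u₀) ∩ K)` (`r ∈ ℝ≥0`; in print `r = q_F^{d(u₀)}`, the index `[Z(u₀) ∩ K : h(Z(u₀) ∩ h⁻¹Kh)h⁻¹ …]`).  Then for EVERY non-zero
`G`-invariant measure `μ` on `G ⧸ Z(u₀)` finite on compact sets and EVERY `F : G → E`: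
  `∫ (1_{U₀}·(F ∘ Ψ))(x u₀ x⁻¹) dμ(ẋ) = r • ∫ F(x u₀ x⁻¹) dμ(ẋ)`.
PROOF.  Pointwise `(1_{U₀}·(F∘Ψ))(xu₀x⁻¹) = F(Ψ(xu₀x⁻¹)) = F(xΨ(u₀)x⁻¹) = F(x·hu₀h⁻¹·x⁻¹)`; ★ p855345 gives `c` with `∫ F(x·hu₀h⁻¹·x⁻¹) dμ = c • ∫ F(xu₀x⁻¹) dμ` and
`c · ρ(Z ∩ hKh⁻¹) = ρ(Z ∩ K)`; since `0 < ρ(Z ∩ hKh⁻¹) < ∞` (★ `measure_preimage_subgroup_pos∕lt_top`), `c = r`.  §2 reads the same identity at the class representative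
`out u` in the ★ `classOrbitalIntegral` currency, which is literally the (SC) clause of ‹Ψ-package› for the family member `mU u`.

HONEST LABEL: count-neutral glue; HC_CM is proved only modulo the 7 printed citations (2 remaining named inputs: hLiu418 = `stmt-HodgeConjecture-24832`, h413 =
`stmt-HodgeConjecture-24833`) until rung 0 closes.  No `sorry`, axioms ⊆ the trio, no `def`, no instance, no notation.

## References
* [HarishChandra1999AdmissibleDistributions] Harish-Chandra (DeBacker–Sally notes), AMS ULS 16 (1999), §3.1 Lemma 3.2 (homogeneity of nilpotent orbital integrals).
* [DeitmarEchterhoff2014] A. Deitmar, S. Echterhoff, *Principles of Harmonic Analysis*, 2nd ed. (2014), Thm. 1.5.3.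
* [Rogawski1990] J. D. Rogawski, *Automorphic Representations of Unitary Groups in Three Variables* (1990), §8.1 Prop. 8.1.2 (b) p. 114.
-/

set_option autoImplicit false
-- the mandated namespace has the single-problem summit's repeated segment (`HodgeConjecture.HodgeConjecture`)
set_option linter.dupNamespace false

noncomputable section

open MeasureTheory MeasureTheory.Measure Topology Set Filter
open Literature.MeasureTheory.Group Literature.NumberTheory.Automorphic
open Summit.HodgeConjecture.HodgeConjecture.Cruxes.H413.K2E3InvariantQuotientNormalizerScaling
open scoped ENNReal NNReal Pointwise

namespace Summit.HodgeConjecture.HodgeConjecture.Cruxes.H413.K2E3UnipotentOrbitalScalingOfIndex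

variable {G : Type*} [Group G] [TopologicalSpace G] [IsTopologicalGroup G] [LocallyCompactSpace G] [SecondCountableTopology G] [T2Space G]
  [MeasurableSpace G] [BorelSpace G]

/-! ## §1 The scaling law at one element -/

set_option maxHeartbeats 800000 in
/-- **THE SCALING LAW OF ONE UNIPOTENT ORBITAL INTEGRAL FROM A NORMALISING CONJUGATOR AND ONE INDEX IDENTITY.**  `Ψ` `Ad`-equivariant on the `Ad`-stable `U₀ ∋` every
conjugate of `u₀`; `h` with `Ψ u₀ = h u₀ h⁻¹` normalising `Z(u₀)`; a compact open subgroup `K` and a left-invariant, open-positive measure `ρ` on `Z(u₀)` finite on compacts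
with `r · ρ(Z(u₀) ∩ hKh⁻¹) = ρ(Z(u₀) ∩ K)`; `ν` a two-sided Haar measure on `G`.  Then `∫ (1_{U₀}·(F ∘ Ψ))(x u₀ x⁻¹) dμ = r • ∫ F(x u₀ x⁻¹) dμ` for every non-zero
invariant `μ` on `G ⧸ Z(u₀)` finite on compacts and every `F` (★ p855345 supplies the constant and its value; positivity of `ρ(Z ∩ hKh⁻¹)` identifies it with `r`).
[cite: HarishChandra1999AdmissibleDistributions, §3.1 Lemma 3.2] [cite: DeitmarEchterhoff2014, Thm. 1.5.3] [cite: Rogawski1990, §8.1 Prop. 8.1.2 (b) p. 114] -/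
theorem integral_descConj_indicator_comp_eq_smul_of_conj_of_index
    (Ψ : G → G) (U₀ : Set G) (hE : ∀ γ ∈ U₀, ∀ x : G, Ψ (x * γ * x⁻¹) = x * Ψ γ * x⁻¹)
    (u₀ : G) (hU : ∀ x : G, x * u₀ * x⁻¹ ∈ U₀)
    {h : G} (hΨ : Ψ u₀ = h * u₀ * h⁻¹)
    (hZ : ∀ z : G, z ∈ Subgroup.centralizer ({u₀} : Set G) ↔ h * z * h⁻¹ ∈ Subgroup.centralizer ({u₀} : Set G))
    (K : Subgroup G) (hKo : IsOpen (K : Set G)) (hKc : IsCompact (K : Set G))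
    (ρ : Measure ↥(Subgroup.centralizer ({u₀} : Set G))) [ρ.IsMulLeftInvariant] [IsFiniteMeasureOnCompacts ρ] [ρ.IsOpenPosMeasure]
    {r : ℝ≥0} (hr : (r : ℝ≥0∞) * ρ (Subtype.val ⁻¹' ((K.map (MulAut.conj h).toMonoidHom : Subgroup G) : Set G)) = ρ (Subtype.val ⁻¹' (K : Set G)))
    (ν : Measure G) [ν.IsHaarMeasure] [ν.IsMulRightInvariant]
    [MeasurableSpace (G ⧸ Subgroup.centralizer ({u₀} : Set G))] [BorelSpace (G ⧸ Subgroup.centralizer ({u₀} : Set G))]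
    (μ : Measure (G ⧸ Subgroup.centralizer ({u₀} : Set G))) [SMulInvariantMeasure G (G ⧸ Subgroup.centralizer ({u₀} : Set G)) μ]
    [IsFiniteMeasureOnCompacts μ] (hμ : μ ≠ 0)
    {E : Type*} [NormedAddCommGroup E] [NormedSpace ℝ E] (F : G → E) :
    ∫ x, descConj u₀ (Subgroup.centralizer ({u₀} : Set G)) (fun _ hg => Subgroup.mem_centralizer_singleton_iff.1 hg) (U₀.indicator (F ∘ Ψ)) x ∂μ =
      r • ∫ x, descConj u₀ (Subgroup.centralizer ({u₀} : Set G)) (fun _ hg => Subgroup.mem_centralizer_singleton_iff.1 hg) F x ∂μ := by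
  haveI hZc : IsClosed (((Subgroup.centralizer ({u₀} : Set G)) : Subgroup G) : Set G) := Set.isClosed_centralizer _
  -- the integrand at `u₀` of `1_{U₀}·(F∘Ψ)` is the integrand at `h u₀ h⁻¹` of `F`
  have hpt : (fun x => descConj u₀ (Subgroup.centralizer ({u₀} : Set G)) (fun _ hg => Subgroup.mem_centralizer_singleton_iff.1 hg) (U₀.indicator (F ∘ Ψ)) x) =
      (fun x => descConj (h * u₀ * h⁻¹) (Subgroup.centralizer ({u₀} : Set G)) (mul_conj_comm_of_normalizes hZ) F x) := by
    funext x
    induction x using QuotientGroup.induction_on with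
    | H y => rw [descConj_mk, descConj_mk, Set.indicator_of_mem (hU y), Function.comp_apply, hE u₀ (by simpa using hU 1) y, hΨ]
  rw [hpt]
  obtain ⟨c, hc, hcK⟩ := exists_orbitalIntegral_conj_eq_smul_of_normalizes u₀ h hZ μ hμ ρ ν
  rw [hc F]
  -- identify `c = r` on the compact open subgroup `K`
  have hval := hcK K hKo hKc
  set K' : Subgroup G := K.map (MulAut.conj h).toMonoidHom with hK'def
  have hK'set : (K' : Set G) = (fun x => h * x * h⁻¹) '' (K : Set G) := by rw [hK'def, Subgroup.coe_map]; rfl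
  have hK'o : IsOpen (K' : Set G) := by
    rw [hK'set]; exact (Homeomorph.mulLeft h |>.trans (Homeomorph.mulRight h⁻¹)).isOpenMap _ hKo
  have hK'c : IsCompact (K' : Set G) := by
    rw [hK'set]; exact hKc.image ((continuous_const.mul continuous_id).mul continuous_const)
  have hpos : ρ (Subtype.val ⁻¹' (K' : Set G)) ≠ 0 := (measure_preimage_subgroup_pos (Subgroup.centralizer ({u₀} : Set G)) ρ K' hK'o).ne'
  have hfin : ρ (Subtype.val ⁻¹' (K' : Set G)) ≠ ∞ := (measure_preimage_subgroup_lt_top (Subgroup.centralizer ({u₀} : Set G)) ρ K' hK'c).ne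
  have hcr : (c : ℝ≥0∞) = (r : ℝ≥0∞) := by
    rw [← hr] at hval
    exact (ENNReal.mul_left_inj hpos hfin).1 hval
  rw [ENNReal.coe_inj.1 hcr]

/-! ## §2 The same at a conjugacy class, in the `classOrbitalIntegral` currency of ★ `ShalikaGermExpansionNonsplit` -/

variable [∀ γ : G, MeasurableSpace (G ⧸ Subgroup.centralizer ({γ} : Set G))] [∀ γ : G, BorelSpace (G ⧸ Subgroup.centralizer ({γ} : Set G))]

set_option maxHeartbeats 800000 in
/-- **THE (SC) CLAUSE OF ‹Ψ-package› AT ONE CLASS `u`**, for an orbital-measure family `m` whose member `m u` is non-zero, `G`-invariant and finite on compacts (★ admissibility at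
`u`): `Φ_m(u, 1_{U₀}·(F∘Ψ)) = r · Φ_m(u, F)`, from the conjugator `h` at the representative `out u` (`Ψ(out u) = h (out u) h⁻¹`, `h` normalising `Z(out u)`) and one index identity
`r · ρ(Z(out u) ∩ hKh⁻¹) = ρ(Z(out u) ∩ K)`.  FILE C proves the data for EVERY element of each unipotent class (its construction is adapted to the element), so `out u` is served.
[cite: HarishChandra1999AdmissibleDistributions, §3.1 Lemma 3.2] [cite: DeitmarEchterhoff2014, Thm. 1.5.3] [cite: Rogawski1990, §8.1 Prop. 8.1.2 (b) p. 114] -/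
theorem classOrbitalIntegral_indicator_comp_eq_mul_of_conj_of_index
    (Ψ : G → G) (U₀ : Set G) (hE : ∀ γ ∈ U₀, ∀ x : G, Ψ (x * γ * x⁻¹) = x * Ψ γ * x⁻¹)
    (u : ConjClasses G) (hU : ∀ x : G, x * (Quotient.out u : G) * x⁻¹ ∈ U₀)
    {h : G} (hΨ : Ψ (Quotient.out u : G) = h * (Quotient.out u : G) * h⁻¹)
    (hZ : ∀ z : G, z ∈ Subgroup.centralizer ({(Quotient.out u : G)} : Set G) ↔ h * z * h⁻¹ ∈ Subgroup.centralizer ({(Quotient.out u : G)} : Set G))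
    (K : Subgroup G) (hKo : IsOpen (K : Set G)) (hKc : IsCompact (K : Set G))
    (ρ : Measure ↥(Subgroup.centralizer ({(Quotient.out u : G)} : Set G))) [ρ.IsMulLeftInvariant] [IsFiniteMeasureOnCompacts ρ] [ρ.IsOpenPosMeasure]
    {r : ℝ≥0} (hr : (r : ℝ≥0∞) * ρ (Subtype.val ⁻¹' ((K.map (MulAut.conj h).toMonoidHom : Subgroup G) : Set G)) = ρ (Subtype.val ⁻¹' (K : Set G)))
    (ν : Measure G) [ν.IsHaarMeasure] [ν.IsMulRightInvariant]
    (m : OrbitalMeasureFamily G) (hm0 : m u ≠ 0) (hinv : SMulInvariantMeasure G (G ⧸ Subgroup.centralizer ({(Quotient.out u : G)} : Set G)) (m u))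
    (hfin : IsFiniteMeasureOnCompacts (m u)) (F : G → ℂ) :
    classOrbitalIntegral m (U₀.indicator (F ∘ Ψ)) u =
      ((r : ℝ) : ℂ) * classOrbitalIntegral m F u := by
  haveI := hinv
  haveI := hfin
  rw [classOrbitalIntegral_eq, classOrbitalIntegral_eq, orbitalIntegral_eq_integral_descConj, orbitalIntegral_eq_integral_descConj,
    integral_descConj_indicator_comp_eq_smul_of_conj_of_index Ψ U₀ hE (Quotient.out u : G) hU hΨ hZ K hKo hKc ρ hr ν (m u) hm0 F,
    NNReal.smul_def, Complex.real_smul]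

end Summit.HodgeConjecture.HodgeConjecture.Cruxes.H413.K2E3UnipotentOrbitalScalingOfIndex

end
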